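import Summits.BirchSwinnertonDyer.Rank1Residual.Partition.MainConjecturesAnticyclotomicGoodThree
import Summits.BirchSwinnertonDyer.Rank1Residual.Partition.MainConjecturesAnticyclotomicGoodClass
import Summits.BirchSwinnertonDyer.Rank1Residual.Partition.MainConjecturesSignedRankOne
import Summits.BirchSwinnertonDyer.Rank1Residual.X9.SurjBigImage
import Literature.NumberTheory.EllipticCurves.SkinnerUrban2014.SemistableCurvesProofs
import HarnessLib

/-!
# Row C3 (Jetchev–Skinner–Wan 2017 Thm. 1.2.1) at MAIN-CONJECTURE level at EVERY prime of the row,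
# `p = 3` INCLUDED, in ONE pair-level statement; its Ribet input DERIVED (cell `b2b-bsdres`, GLUE seat
# gen 5; companion of `MainConjecturesAnticyclotomicGood{Class,Three}.lean`, `MainConjecturesSignedRankOne.lean`)

HONEST FRAMING (cell `b2b-bsdres`, run/shared/lean/b2b/bsd-rank1-residual/, verbatim in every
file): the goal of the cell is to DELETE the COMBINATION-SHAPED residual classes of the
Birch–Swinnerton-Dyer formula for ALL analytic-rank `≤ 1` elliptic curves over `ℚ` — "full BSD
formula for every rank `≤ 1` curve in class `C`" assembled STRICTLY from published theorems — so
that the rank-`≤ 1` remainder becomes exactly the CONSTRUCTION-SHAPED classes, which are TYPED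
(missing-input `Prop`s), NOT attempted. This is not "finishing BSD". Research routes; no claim
beyond the stated classes; nothing booked; no label changes. THEOREMS ONLY (no definition, no named
fact, no `sorry`); every published theorem enters as one of the tree's existing named Literature
facts BY NAME; every unproved / untyped-in-Literature statement enters as an EXPLICIT binder.

## What this file records

Row C3 = `RowC3 W p`: `r = 1`, `E` semistable, `p` good, `E[p]` irreducible, `p ≥ 5 ∨ (p = 3 ∧
(ordinary ∨ a_3 = 0))`. Gens 3/4 gave its MAIN-CONJECTURE-level objects on two sub-loci:
`RowC3.bsdp_of_onTreeGoodLinks_of_bcsThm112b` (ordinary, `p ≥ 5`, `p ∤ ∏c_ℓ`; the cyclotomic MC of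
the twist = BCS 2025 Thm. 1.1.2 (b), CLASS-quantified anticyclotomic links, the JSW §7.4 Ribet fact
`hRib`) and `RowC3.bsdp_rankOne_ss_of_kobayashiMainConjecture_of_corA5` (supersingular: the typed OPEN
Kobayashi MC + BKO Cor. A.5). Missing: `p = 3` ORDINARY. Here:

* `RowC3.ram` — the (ram) prime of a row-C3 pair is DERIVED at every `p` of the row from modularity
  (`exists_isNewformOf`) + level lowering (`diamond1995_refinedSerre`) by lit-su's Ribet lemma
  `SkinnerUrban2014.ram_of_semistable_of_irr` (odd `p`; JSW 2017 §7.4's remark — the registry fact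
  `JetchevSkinnerWan2017.sec74_exists_ramifiedPrime_of_semistable` (A144) is thereby not an input);
  hence `Surj` and BCS's (im) (`RowC3.surj`, `RowC3.bigIm`), and at `p = 3` ordinary a row-C3 pair IS
  a row-C16 pair (`RowC3.rowC16_of_goodOrd`: `p = 3`, good ordinary, (irr), (ram)).
* `RowC3.bsdp_ord_of_onTreeGoodLinks_of_columnMainConjectures` — **the ORDINARY part of row C3 at
  EVERY prime of the row (`p = 3` included), on `p ∤ ∏c_ℓ`, PAIR-level**: the column's cyclotomic
  main conjecture for the twist as the PUBLISHED named fact of the prime at hand — BCS 2025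
  Thm. 1.1.2 (b) (`hBCS`, `p > 3`) / Yan–Zhu 2026 Thm. 4.9 (`hYZ`, `p = 3`; (im) at `3` from surj(3)
  by Wuthrich 2014 Lemma 20 `hW20`) — + the anticyclotomic main conjecture (one divisibility ∘ BDP)
  and the anticyclotomic control theorem AS TYPED ON THE CONSTRUCTED `X_ac` at THIS pair's classical
  Heegner data (`hLA`, `hLC`: Castella 2018 Thm. 2.3 / 3.2 shapes with `ε_p = p⁻¹`, BCS Thm. 1.2.4 /
  YZ Thm. 4.12 in print) + Gross–Zagier, Kolyvagin, Greenberg 4.1, Hoffstein–Luo, Mazur, Néron,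
  modularity, GZK — through gen 3's generic odd-prime theorem
  `bsdp_rankOne_of_onTreeGoodLinks_of_columnMainConjecture_odd`.
* `RowC3.bsdp_of_mainConjectures_of_onTreeGoodLinks` — **row C3 ENTIRELY at main-conjecture level,
  every prime of the row**: ordinary as above; supersingular (`p ∣ a_p`) from the typed signed main
  conjecture `Supersingular.KobayashiMainConjecture W p ε` (OPEN in print for non-CM `E` — announced
  BSTW arXiv:2409.01350, never a theorem here) + Burungale–Kobayashi–Ota 2024 Cor. A.5 (gen 4).
  The Tamagawa proviso `p ∤ ∏c_ℓ` is asked only on the ordinary branch (where STEP L and Kolyvagin's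
  bound meet; JSW §7.4.2 removes it in print by a field `K″` with the `p ∣ c_w` primes inert — a
  Shimura-curve Heegner currency the tree does not have).

References: [JetchevSkinnerWan2017] Thm. 1.2.1, §7.4, §7.4.1–7.4.2; [BurungaleCastellaSkinner2025]
Thm. 1.1.2 (b), Thm. 1.2.4, Cor. 1.3.1; [YanZhu2024MainConjNonCM] Thm. 4.9, 4.12, 4.15; [Castella2018]
Thm. 2.3, 3.2; [Wuthrich2014] Lemma 20; [Diamond1995RefinedSerre]; [SkinnerUrban2014] §3.6;
[BurungaleKobayashiOta2023] App. A Cor. A.5; [Kobayashi2003] Conjecture p. 2; [Miller2011LMS] Def. 1.1;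
RESIDUAL-CASES.md §a.1 row C3; HOME/b2b-bsdres-lit-su/SU2014-TYPING.md §11.4 (v).
-/

set_option autoImplicit false

noncomputable section

open scoped Classical

open WeierstrassCurve NumberField IsDedekindDomain Literature.NumberTheory.EllipticCurves
  Literature.NumberTheory.EllipticCurves.ModularForms Literature.NumberTheory.Automorphic
  Literature.NumberTheory.EllipticCurves.Rank1Residual
  Literature.NumberTheory.EllipticCurves.YanZhu2026
  Literature.NumberTheory.EllipticCurves.BurungaleCastellaSkinner2025
  Literature.NumberTheory.EllipticCurves.BurungaleKobayashiOta2024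
  Summit.BirchSwinnertonDyer.BirchSwinnertonDyer.Theorems.Rank1ResidualX1Defs

namespace Summit.BirchSwinnertonDyer.Rank1Residual

section Curve

variable {W : WeierstrassCurve ℚ} [W.IsElliptic] [W.IsGloballyMinimal] {p : ℕ} [Fact p.Prime]

/-! ### §1. The (ram) prime of a row-C3 pair, derived -/

/-- **A row-C3 pair has a (ram) prime** (a multiplicative `ℓ ≠ p` with `p ∤ v_ℓ(Δ_min)`), at EVERY
prime of the row (`p = 3` included): `E` semistable, `E[p]` irreducible, `p` odd and good ⇒ (ram), by
level lowering — lit-su's `SkinnerUrban2014.ram_of_semistable_of_irr` from modularity (`hnf`) and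
Diamond's refined Serre conjecture (`hLL`); JSW 2017 §7.4 (first paragraph). The registry fact
`JetchevSkinnerWan2017.sec74_exists_ramifiedPrime_of_semistable` is NOT an input.
[cite: JetchevSkinnerWan2017, §7.4 (first paragraph, p. 29 of arXiv:1512.06894)]
[cite: Diamond1995RefinedSerre, Thm. 1.1] -/
theorem RowC3.ram (hnf : exists_isNewformOf) (hLL : diamond1995_refinedSerre) (h : RowC3 W p) :
    Ram W p :=
  SkinnerUrban2014.ram_of_semistable_of_irr hnf hLL W p (RowC3.ne_two h) h.2.2.1 h.2.1 h.2.2.2.1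

/-- Hence `ρ̄_{E,p}` is surjective on a row-C3 pair ((irr) + (ram), `surj_of_irr_of_ram`).
[cite: Serre1972, §2.4 Prop. 15] -/
theorem RowC3.surj (hnf : exists_isNewformOf) (hLL : diamond1995_refinedSerre) (h : RowC3 W p) :
    Surj W p :=
  surj_of_irr_of_ram W p h.2.2.2.1 (RowC3.ram hnf hLL h)

/-- … and BCS's (im) holds on a row-C3 pair at every prime of the row (`X9.bigIm_of_irr_of_ram`).
[cite: BurungaleCastellaSkinner2025, hypothesis (im) (p. 2)] -/
theorem RowC3.bigIm (hnf : exists_isNewformOf) (hLL : diamond1995_refinedSerre) (h : RowC3 W p) :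
    BigIm W p :=
  X9.bigIm_of_irr_of_ram W p h.2.2.2.1 (RowC3.ram hnf hLL h)

/-- **At `p = 3` ordinary a row-C3 pair is a row-C16 pair** (`p = 3`, good ordinary, (irr), surj ∨
(ram) — here (ram)). [cite: YanZhu2024MainConjNonCM, Thm. 4.15 (hypotheses)] -/
theorem RowC3.rowC16_of_goodOrd (hnf : exists_isNewformOf) (hLL : diamond1995_refinedSerre)
    (h : RowC3 W p) (hp3 : p = 3) (hord : GoodOrd W p) : RowC16 W p :=
  ⟨hp3, hord, h.2.2.2.1, Or.inr (RowC3.ram hnf hLL h)⟩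

end Curve

/-! ### §2. Row C3, ordinary, at every prime of the row, pair level -/

/-- **Row C3 ∩ {ordinary, `p ∤ ∏c_ℓ`} at main-conjecture level at EVERY prime of the row (`p = 3`
INCLUDED), PAIR level.** For a row-C3 pair `(E, p)` (`h`) with `p ∤ a_p` (`hord`) and `p ∤ ∏c_ℓ`
(`htam0`): the cyclotomic main conjecture of the column as the PUBLISHED named fact of the prime at
hand — Burungale–Castella–Skinner 2025 Thm. 1.1.2 (b) (`hBCS`, used when `p > 3`) / Yan–Zhu 2026
Thm. 4.9 (`hYZ`, used when `p = 3`, with (im) at `3` for the twist from surj(3) by Wuthrich 2014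
Lemma 20 `hW20`) — + the anticyclotomic main conjecture (one divisibility ∘ BDP) `hLA` and the
anticyclotomic control theorem `hLC` AS TYPED ON THE CONSTRUCTED `X_ac` at this pair's Manin-unit
classical Heegner data (PUBLISHED shapes: BCS Thm. 1.2.4 / YZ Thm. 4.12 ∘ Cas18 Thm. 3.2; Cas18
Thm. 2.3 ⇐ JSW Thm. 3.3.1) + Gross–Zagier (`hGZ`), Kolyvagin (`hKo`, `hB`), Greenberg 4.1 (`hGr`),
Hoffstein–Luo (`hHL`), Mazur (`hMaz`), Néron (`hNS`), modularity (`hmod`, `hpar`, `hnf`), level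
lowering (`hLL`, for (ram) ⇒ surj), GZK ⇒ `BSD(E,p)`. Proof: (ram) is derived (`RowC3.ram`), so
`ρ̄_{E,p}` is onto, and gen 3's generic odd-prime theorem
`bsdp_rankOne_of_onTreeGoodLinks_of_columnMainConjecture_odd` applies with the column MC / (im)
witness chosen by `p = 3 ∨ p ≥ 5`. [cite: JetchevSkinnerWan2017, Thm. 1.2.1 and §7.4.1]
[cite: BurungaleCastellaSkinner2025, Thm. 1.1.2 (b), Thm. 1.2.4] [cite: YanZhu2024MainConjNonCM, Thm. 4.9, Thm. 4.12]
[cite: Castella2018, Thm. 2.3 (p. 5), Thm. 3.2 (p. 9)] [cite: Wuthrich2014, Lemma 20 (p. 399)]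
[cite: Miller2011LMS, Def. 1.1] -/
theorem RowC3.bsdp_ord_of_onTreeGoodLinks_of_columnMainConjectures
    (hGZ : ∀ (N : ℕ) [NeZero N] (W : WeierstrassCurve ℚ) (K : Type) [Field K] [NumberField K],
      gross_zagier N W K)
    (hKo : ∀ (N : ℕ) [NeZero N] (W : WeierstrassCurve ℚ) (K : Type) [Field K] [NumberField K],
      kolyvagin N W K)
    (hB : ∀ (N : ℕ) [NeZero N] (W : WeierstrassCurve ℚ) (K : Type) [Field K] [NumberField K],
      Kolyvagin1990_padicValNat_card_sha_le N W K)
    (hBCS : thm112b_charIdeal_eq_padicLFunction_integral)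
    (hYZ : thm49_charIdeal_eq_padicLFunction_integral)
    (hW20 : Wuthrich2014.lemma20_surjective_threeAdic_of_semistable)
    (hGr : greenberg_charValue_rankZero) (hGZK : rank_eq_analyticRank_of_analyticRank_le_one)
    (hmod : hasEntireLFunction_rat) (hpar : nonempty_modularParametrizationData)
    (hnf : exists_isNewformOf) (hLL : diamond1995_refinedSerre)
    (hHL : HoffsteinLuo1997_exists_twist_L_one_ne_zero)
    (hMaz : mazur_not_dvd_maninConstant_of_odd) (hNS : integral_neronScaling_of_isGloballyMinimal)
    (W : WeierstrassCurve ℚ) [W.IsElliptic] [W.IsGloballyMinimal] (p : ℕ) [Fact p.Prime]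
    (h : RowC3 W p) (hord : GoodOrd W p) (htam0 : ¬ p ∣ W.tamagawaProduct)
    (hLC : ∀ (N : ℕ) [NeZero N] (K : Type) [Field K] [NumberField K]
      (Dt : ModularParametrizationData W N) (H : HeegnerDatum N (NumberField.discr K)) (ι : K →+* ℂ)
      (P : (W.baseChange K).toAffine.Point),
      W.conductorNorm ℤ = N → IsImaginaryQuadratic K → Odd (NumberField.discr K) →
      NumberField.discr K < -4 → SatisfiesHeegnerHypothesis N K → SatisfiesHeegnerHypothesis p K →
      (W.quadraticTwist (NumberField.discr K : ℚ)).entireLFunction 1 ≠ 0 →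
      WeierstrassCurve.Affine.Point.map ι.toRatAlgHom P = heegnerPointComplex Dt H →
      ¬ (p : ℤ) ∣ Dt.c → ¬ IsOfFinAddOrder P →
      ∀ (κ : ZpExtension K p), κ.IsAnticyclotomic →
        ∀ (γ : Field.absoluteGaloisGroup K) [Fact (κ.IsTopGenerator γ)]
          (𝔭 : HeightOneSpectrum (𝓞 K)) (h𝔭 : ((p : ℕ) : 𝓞 K) ∈ 𝔭.asIdeal)
          (he : 𝔭.asIdeal.ramificationIdx (𝓞 ℚ) = 1) (hf : 𝔭.asIdeal.inertiaDeg (𝓞 ℚ) = 1),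
          X11b.ControlOnTreeGoodAt p κ 𝔭 γ (X11b.embAt K p 𝔭 h𝔭 he hf) P)
    (hLA : ∀ (N : ℕ) [NeZero N] (K : Type) [Field K] [NumberField K]
      (Dt : ModularParametrizationData W N) (H : HeegnerDatum N (NumberField.discr K)) (ι : K →+* ℂ)
      (P : (W.baseChange K).toAffine.Point),
      W.conductorNorm ℤ = N → IsImaginaryQuadratic K → Odd (NumberField.discr K) →
      NumberField.discr K < -4 → SatisfiesHeegnerHypothesis N K → SatisfiesHeegnerHypothesis p K →
      (W.quadraticTwist (NumberField.discr K : ℚ)).entireLFunction 1 ≠ 0 →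
      WeierstrassCurve.Affine.Point.map ι.toRatAlgHom P = heegnerPointComplex Dt H →
      ¬ (p : ℤ) ∣ Dt.c → ¬ IsOfFinAddOrder P →
      ∀ (κ : ZpExtension K p), κ.IsAnticyclotomic →
        ∀ (γ : Field.absoluteGaloisGroup K) [Fact (κ.IsTopGenerator γ)]
          (𝔭 : HeightOneSpectrum (𝓞 K)) (h𝔭 : ((p : ℕ) : 𝓞 K) ∈ 𝔭.asIdeal)
          (he : 𝔭.asIdeal.ramificationIdx (𝓞 ℚ) = 1) (hf : 𝔭.asIdeal.inertiaDeg (𝓞 ℚ) = 1),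
          X11b.IMCLowerWaldspurgerOnTreeGoodAt p κ 𝔭 γ (X11b.embAt K p 𝔭 h𝔭 he hf) P) :
    BSDp W p := by
  have hr1 : W.analyticRank = 1 := h.1
  have hp : 5 ≤ p ∨ p = 3 ∧ (GoodOrd W p ∨ W.frobeniusTrace 3 = 0) := h.2.2.2.2
  have hp3 : 3 ≤ p := by rcases hp with h5 | ⟨h3, -⟩ <;> omega
  have hsurj : Surj W p := RowC3.surj hnf hLL h
  refine bsdp_rankOne_of_onTreeGoodLinks_of_columnMainConjecture_odd hGZ hKo hB hGr hGZK hmod hpar hnf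
    hHL hMaz hNS W p hp3 hord hsurj hr1 htam0 ?_ ?_ hLC hLA
  · -- the column's cyclotomic main conjecture at `p`: BCS (b) for `p > 3`, Yan–Zhu Thm. 4.9 at `p = 3`
    intro V _ _ hordV hirrV himV
    by_cases h5 : 5 ≤ p
    · exact hBCS V p (by omega) hordV hirrV himV
    · have h3 : p = 3 := by rcases hp with h | ⟨h, -⟩ <;> omega
      subst h3
      exact hYZ V 3 le_rfl hordV hirrV himV
  · -- (im) from surj at `p`: Serre's lemma for `p ≥ 5`, Wuthrich Lemma 20 at `p = 3`
    intro V _ _ hordV hsV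
    by_cases h5 : 5 ≤ p
    · exact X9.bigIm_of_surj V p h5 hsV
    · have h3 : p = 3 := by rcases hp with h | ⟨h, -⟩ <;> omega
      subst h3
      exact X9.bigIm_three_of_surj V hW20 (Or.inl hordV.1) hsV

/-! ### §3. Row C3 entirely at main-conjecture level, every prime of the row -/

/-- **Row C3 ENTIRELY at main-conjecture level, at EVERY prime of the row (`p = 3` included), PAIR
level.** By cases on `p ∣ a_p`:
* ordinary (`p ∤ a_p`; then `p ∤ ∏c_ℓ` is asked, `htam0`): the PUBLISHED cyclotomic main conjecture of
  the column (BCS 2025 Thm. 1.1.2 (b) / Yan–Zhu 2026 Thm. 4.9) + the anticyclotomic main conjecture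
  and control AS TYPED on `X_ac` (`hLA`, `hLC`) + cited control —
  `RowC3.bsdp_ord_of_onTreeGoodLinks_of_columnMainConjectures`;
* supersingular (`p ∣ a_p`): the typed signed main conjecture `Supersingular.KobayashiMainConjecture
  W p ε` for one sign (`hKMC` — OPEN in print for non-CM `E`; announced BSTW Thm. 1.3, NOT a theorem
  here) + Burungale–Kobayashi–Ota 2024 Cor. A.5 (`hA5`) + modularity + GZK — gen 4's
  `RowC3.bsdp_rankOne_ss_of_kobayashiMainConjecture_of_corA5`.
So row C3 reads, in the kernel, at every prime: "(main conjectures, as typed: PUBLISHED named facts on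
the ordinary branch, the OPEN Kobayashi predicate on the supersingular one) + (control / links, as
typed) ⇒ `BSD(E,p)`". [cite: JetchevSkinnerWan2017, Thm. 1.2.1, §7.4.1–7.4.2]
[cite: BurungaleCastellaSkinner2025, Thm. 1.1.2 (b)] [cite: YanZhu2024MainConjNonCM, Thm. 4.9]
[cite: Kobayashi2003, Conjecture (p. 2)] [cite: BurungaleKobayashiOta2023, App. A Cor. A.5]
[cite: Miller2011LMS, Def. 1.1] -/
theorem RowC3.bsdp_of_mainConjectures_of_onTreeGoodLinks
    (hGZ : ∀ (N : ℕ) [NeZero N] (W : WeierstrassCurve ℚ) (K : Type) [Field K] [NumberField K],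
      gross_zagier N W K)
    (hKo : ∀ (N : ℕ) [NeZero N] (W : WeierstrassCurve ℚ) (K : Type) [Field K] [NumberField K],
      kolyvagin N W K)
    (hB : ∀ (N : ℕ) [NeZero N] (W : WeierstrassCurve ℚ) (K : Type) [Field K] [NumberField K],
      Kolyvagin1990_padicValNat_card_sha_le N W K)
    (hBCS : thm112b_charIdeal_eq_padicLFunction_integral)
    (hYZ : thm49_charIdeal_eq_padicLFunction_integral)
    (hW20 : Wuthrich2014.lemma20_surjective_threeAdic_of_semistable)
    (hA5 : corA5_pPart_of_signedCharIdeal_eq)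
    (hGr : greenberg_charValue_rankZero) (hGZK : rank_eq_analyticRank_of_analyticRank_le_one)
    (hmod : hasEntireLFunction_rat) (hpar : nonempty_modularParametrizationData)
    (hnf : exists_isNewformOf) (hLL : diamond1995_refinedSerre)
    (hHL : HoffsteinLuo1997_exists_twist_L_one_ne_zero)
    (hMaz : mazur_not_dvd_maninConstant_of_odd) (hNS : integral_neronScaling_of_isGloballyMinimal)
    (W : WeierstrassCurve ℚ) [W.IsElliptic] [W.IsGloballyMinimal] (p : ℕ) [Fact p.Prime]
    (h : RowC3 W p) (htam0 : GoodOrd W p → ¬ p ∣ W.tamagawaProduct)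
    -- the typed signed main conjecture, asked only on the supersingular branch
    (ε : ℤˣ) (hKMC : (p : ℤ) ∣ W.frobeniusTrace p → Supersingular.KobayashiMainConjecture W p ε)
    -- the two on-tree anticyclotomic links at this pair's classical Heegner data (ordinary branch)
    (hLC : ∀ (N : ℕ) [NeZero N] (K : Type) [Field K] [NumberField K]
      (Dt : ModularParametrizationData W N) (H : HeegnerDatum N (NumberField.discr K)) (ι : K →+* ℂ)
      (P : (W.baseChange K).toAffine.Point),
      W.conductorNorm ℤ = N → IsImaginaryQuadratic K → Odd (NumberField.discr K) →
      NumberField.discr K < -4 → SatisfiesHeegnerHypothesis N K → SatisfiesHeegnerHypothesis p K →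
      (W.quadraticTwist (NumberField.discr K : ℚ)).entireLFunction 1 ≠ 0 →
      WeierstrassCurve.Affine.Point.map ι.toRatAlgHom P = heegnerPointComplex Dt H →
      ¬ (p : ℤ) ∣ Dt.c → ¬ IsOfFinAddOrder P →
      ∀ (κ : ZpExtension K p), κ.IsAnticyclotomic →
        ∀ (γ : Field.absoluteGaloisGroup K) [Fact (κ.IsTopGenerator γ)]
          (𝔭 : HeightOneSpectrum (𝓞 K)) (h𝔭 : ((p : ℕ) : 𝓞 K) ∈ 𝔭.asIdeal)
          (he : 𝔭.asIdeal.ramificationIdx (𝓞 ℚ) = 1) (hf : 𝔭.asIdeal.inertiaDeg (𝓞 ℚ) = 1),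
          X11b.ControlOnTreeGoodAt p κ 𝔭 γ (X11b.embAt K p 𝔭 h𝔭 he hf) P)
    (hLA : ∀ (N : ℕ) [NeZero N] (K : Type) [Field K] [NumberField K]
      (Dt : ModularParametrizationData W N) (H : HeegnerDatum N (NumberField.discr K)) (ι : K →+* ℂ)
      (P : (W.baseChange K).toAffine.Point),
      W.conductorNorm ℤ = N → IsImaginaryQuadratic K → Odd (NumberField.discr K) →
      NumberField.discr K < -4 → SatisfiesHeegnerHypothesis N K → SatisfiesHeegnerHypothesis p K →
      (W.quadraticTwist (NumberField.discr K : ℚ)).entireLFunction 1 ≠ 0 →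
      WeierstrassCurve.Affine.Point.map ι.toRatAlgHom P = heegnerPointComplex Dt H →
      ¬ (p : ℤ) ∣ Dt.c → ¬ IsOfFinAddOrder P →
      ∀ (κ : ZpExtension K p), κ.IsAnticyclotomic →
        ∀ (γ : Field.absoluteGaloisGroup K) [Fact (κ.IsTopGenerator γ)]
          (𝔭 : HeightOneSpectrum (𝓞 K)) (h𝔭 : ((p : ℕ) : 𝓞 K) ∈ 𝔭.asIdeal)
          (he : 𝔭.asIdeal.ramificationIdx (𝓞 ℚ) = 1) (hf : 𝔭.asIdeal.inertiaDeg (𝓞 ℚ) = 1),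
          X11b.IMCLowerWaldspurgerOnTreeGoodAt p κ 𝔭 γ (X11b.embAt K p 𝔭 h𝔭 he hf) P) :
    BSDp W p := by
  by_cases hdvd : (p : ℤ) ∣ W.frobeniusTrace p
  · -- supersingular: typed Kobayashi MC (one sign) + BKO Cor. A.5
    exact RowC3.bsdp_rankOne_ss_of_kobayashiMainConjecture_of_corA5 hA5 hmod hGZK h hdvd ε (hKMC hdvd)
  · -- ordinary: published cyclotomic MC of the column + on-tree anticyclotomic links
    have hord : GoodOrd W p := ⟨h.2.2.1, hdvd⟩
    exact RowC3.bsdp_ord_of_onTreeGoodLinks_of_columnMainConjectures hGZ hKo hB hBCS hYZ hW20 hGr hGZK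
      hmod hpar hnf hLL hHL hMaz hNS W p h hord (htam0 hord) hLC hLA

end Summit.BirchSwinnertonDyer.Rank1Residual

end
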